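import Literature.NumberTheory.Rogawski1990.LocalEndoscopicCentralDockFormCM        -- ★ p842275 F0P3-p01 (g13): `finKappaAt_dock_conj_eq_neg_of_formCongr_eq_smul` (the κ-flip for `ᵗ(σy)H′_v y = a₀·Φ₃`)
import Literature.NumberTheory.Rogawski1990.FinExplicitTransferFactorTorusDockSplit  -- ★ p842204 B-p08 (g27): `isLocalNormPair_of_frames_of_val_eq_conj`, `val_endoGL_frame_conj`, `eval_finCharpolyTwo_eq_of_frame`
import Literature.NumberTheory.Rogawski1990.LocalStableClassesHTwo                  -- ★ p842188 F0P3-p02 (g11): (J2a)(i); brings ★ B-p04 `exists_isStablyConj_not_isConj_forall_isConj_or_rankTwo`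
import Literature.NumberTheory.Rogawski1990.LocalHyperbolicClassIsLevi              -- ★ `forall_norm_eq_one_or_hyperbolic`, `LocalRing.isField_of_smul_eq`
import HarnessLib

/-!
# (J2a) THE κ-ALTERNATION AT THE TORUS BASE — the binder `halt` of the torus unstable junction, DISCHARGED along the central dock
# (Rogawski 1990 §8.2 Prop. 8.2.1 (c), §4.3 (4.3.2), §3.5 Prop. 3.5.2 (c); Labesse–Langlands 1979 §2)

Topic `NumberTheory/Rogawski1990`; namespace `Literature.NumberTheory.Rogawski1990`.  THEOREMS ONLY (no definition, no instance, no notation, no named fact,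
no `sorry`); imports = ★ tree modules.  Cell `pub/hodgecm-mathlib`, crux H413 = `stmt-HodgeConjecture-24833`, floor-2 line «N6nsGerm» (`Cruxes/H413/Lines/F0_P3a_N6nsGerm.lean`),
stub `stub_N6nsS2`; LEAD F0P3a-plan (g9) WORD T8-139 (1) «(J2a) `halt` DISCHARGE AS ONE NAMED HEAD» → F0P3-p02 (g12).  Consumers: B-p08 (g27) ★ p842287
`exists_nhds_finsum_delta_dock_eq_locallyConstant_of_frame` (its binder `halt`), A-p19 (g22) S2 DRESS.

THE MATHEMATICS.  Non-split finite place `v` of `L⁺` (`w ∣ v`, `w̄ = w`), `H_v = U(Φ₂)(L⁺_v) × U(Φ₁)(L⁺_v)`, `G′_v = U(H′)(L⁺_v)`.  Along the torus `C = Z_H(ε_H)`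
diagonalised by the eigenframe `P` of `ε_H.1` (`t = (P·diag(α_t, β_t)·P⁻¹, γ_t)`, ★ `exists_torusTransport_frame`), the transport `τ t = (P·diag(α_t, γ_t)·P⁻¹, β_t)` and a
dock `θ : H_v ≃ₜ* Z_{G′_v}(ε)`, `θ z = y·ι_v(z)·y⁻¹`, whose conjugator carries `U(H′)`'s form to `a₀·Φ₃` (★ `exists_centralDock_form_of_fst_eq_smul_one`).  For `G`-regular `t`:
* `α_t, β_t, γ_t` are pairwise distinct (`χ_{t.1}(γ_t)`, `χ_{(τ t).1}(β_t)` units: ★ `isUnit_eval_finCharpolyTwo_of_isLocalGRegular` at `t` and at `τ t`) and of NORM ONE (`γ_t` sits in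
  `U(Φ₁)`; for `α_t, β_t` ★ `forall_norm_eq_one_or_hyperbolic` on `t.1` and `(τ t).1` in the common frame `P`: a hyperbolic pair `σ(α)β = 1` would force `α = β` or `β = γ`);
* so `(τ t).1` is a split regular element of `U(Φ₂)_v` and its `H_v`-stable class is EXACTLY TWO classes `{⟦τ t⟧, ⟦h′⟧}`, `h′ = (x·(τ t).1·x⁻¹, β_t)` with the stable conjugator
  `x ∈ GL₂(L_w)` FAILING the `Φ₂`-norm test at both columns of `P` (★ B-p04 `exists_isStablyConj_not_isConj_forall_isConj_or_rankTwo`, ★ `normTest_zero_iff_normTest_one_rankTwo`;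
  the `U(Φ₁)`-components of stably conjugate elements agree, ★ `IsLocalStablyConjH.snd_eq`);
* on the dock, `θ(τ t)` has the eigenframe `y·ι(P, 1)` with eigenvalues `(α_t, β_t, γ_t)` and `θ h′ = g·θ(τ t)·g⁻¹`, `g = y·ι(x, 1)·y⁻¹`; the FIRST slot `↑t` of `Δ‴_v` has
  `U(Φ₁)`-coordinate `γ_t`, which sits at the PLANE slot `2` of that frame, where `x` fails the test — so `κ_v(↑t, θ h′) = −κ_v(↑t, θ(τ t))` (★
  `finKappaAt_dock_conj_eq_neg_of_formCongr_eq_smul`), both pairs are matched (★ `isLocalNormPair_of_frames_of_val_eq_conj` + `GL₃`-conjugacy), and `Δ‴_v = τ_v·D_{G∕H,v}·κ_v`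
  (★ `finExplicitDelta_of_isLocalNormPair`) FLIPS SIGN;
* `Δ‴_v(↑t, ·)` is a class function in the second slot (`hr`), so the same holds at the chosen representatives `θ(out ⟦·⟧)`.
This is Rogawski's «we reduce to a problem on SL₂ dealt with in [LL]» (Prop. 8.2.1 (c)): the two classes inside the stable class of a regular element of the anisotropic torus of
`U(1,1)` carry opposite signs of the endoscopic character.

* `exists_isLocalStablyConjH_finExplicitDelta_dock_eq_neg` — element form at one `G`-regular torus point.
* **`exists_nhds_stableClass_pair_delta_dock_eq_neg_of_frame`** — the binder `halt` of ★ `exists_nhds_finsum_delta_dock_eq_locallyConstant_of_torusTransfer` ∕ `…_of_frame` VERBATIM.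
HONEST LABEL: HC_CM is proved only modulo the 2 remaining named inputs (hLiu418, h413) until rung 0 closes; this file is linear algebra over ★ modules and pays the (J2a) binder only.

## References
* [Rogawski1990] J. D. Rogawski, *Automorphic Representations of Unitary Groups in Three Variables*, Ann. of Math. Stud. 123 (1990), §3.5 Prop. 3.5.2 (c) p. 29, §3.6 p. 31,
  §4.3 (4.3.2) p. 43, §4.9 p. 55, §8.2 Prop. 8.2.1 (c) pp. 113–115.
* [LabesseLanglands1979] J.-P. Labesse, R. P. Langlands, *L-indistinguishability for SL(2)*, Canad. J. Math. 31 (1979), §2.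
* [LanglandsShelstad1987] R. P. Langlands, D. Shelstad, *On the definition of transfer factors*, Math. Ann. 278 (1987), §1.
-/

set_option autoImplicit false

noncomputable section

open NumberField IsDedekindDomain Matrix Topology Filter
open scoped MatrixGroups

namespace Literature.NumberTheory.Rogawski1990

open Literature.NumberTheory.Automorphic Literature.NumberTheory.Automorphic.UnitaryGroup
open Literature.NumberTheory.GaloisRepresentations
open Literature.AlgebraicGeometry.ShimuraVarieties (unitaryGroup)

/-! ## §0 Small generic facts -/

/-- Conjugacy in a product of groups is componentwise. [folklore] -/
private theorem isConj_prod_mk_iff_of_components {A B : Type*} [Group A] [Group B] {a a' : A} {b b' : B} :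
    IsConj (a, b) (a', b') ↔ IsConj a a' ∧ IsConj b b' := by
  constructor
  · intro h
    exact ⟨MonoidHom.map_isConj (MonoidHom.fst A B) h, MonoidHom.map_isConj (MonoidHom.snd A B) h⟩
  · rintro ⟨ha, hb⟩
    obtain ⟨c, hc⟩ := isConj_iff.1 ha
    obtain ⟨d, hd⟩ := isConj_iff.1 hb
    exact isConj_iff.2 ⟨(c, d), by rw [Prod.mk_mul_mk, Prod.inv_mk, Prod.mk_mul_mk, hc, hd]⟩

/-- `![a, b]` is injective when `a ≠ b`. [folklore] -/
private theorem injective_vecTwo_of_ne {β : Type*} {a b : β} (hab : a ≠ b) : Function.Injective ![a, b] := by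
  intro i j h
  fin_cases i <;> fin_cases j <;> simp at h ⊢
  · exact hab h
  · exact hab h.symm

/-- `![a, b, c]` is injective when `a, b, c` are pairwise distinct. [folklore] -/
private theorem injective_vecThree_of_pairwise_ne {β : Type*} {a b c : β} (hab : a ≠ b) (hac : a ≠ c) (hbc : b ≠ c) : Function.Injective ![a, b, c] := by
  intro i j h
  fin_cases i <;> fin_cases j <;> simp at h ⊢
  · exact hab h
  · exact hac h
  · exact hab h.symm
  · exact hbc h
  · exact hac h.symm
  · exact hbc h.symm

/-- The diagonal pattern `!![a, 0, 0; 0, b, 0; 0, 0, c]` is `diagonal ![a, b, c]`. [folklore] -/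
private theorem etaExpand_eq_diagonal_three {S : Type*} [Zero S] (a b c : S) : !![a, 0, 0; 0, b, 0; 0, 0, c] = diagonal ![a, b, c] := by
  ext i j
  fin_cases i <;> fin_cases j <;> rfl

section CM

variable (L : Type) [Field L] [NumberField L] [IsCMField L] (H' : Matrix (Fin 3) (Fin 3) L) (v : HeightOneSpectrum (𝓞 ↥(maximalRealSubfield L)))

omit [IsCMField L] in
/-- The local form of `Φ₂` over `∏_{w∣v} L_w` is the literal `antidiag(1, 1)`. [cite: Rogawski1990, §3.5 p. 29] -/
private theorem localForm_antidiagTwo_eq_literal :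
    (adelicForm L 2 (Matrix.of fun i j : Fin 2 => if i.val + j.val + 1 = 2 then (1 : L) else 0)).map (adeleToLocal L v) =
      Matrix.of fun i j : Fin 2 => if i.val + j.val + 1 = 2 then (1 : LocalRing L v) else 0 := by
  rw [adelicForm_map_adeleToLocal]
  ext i j
  simp only [map_apply, of_apply]
  split_ifs <;> simp

omit [IsCMField L] in
/-- `∏_{w∣v} L_w` is non-trivial (there is a place above `v`). [cite: CasselsFrohlichANT1967, Ch. II §10] -/
private theorem nontrivial_localRing_of_nonempty_placesOver : Nontrivial (LocalRing L v) := by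
  obtain ⟨w⟩ := (inferInstance : Nonempty (PlacesOver L v))
  exact ⟨⟨0, 1, fun h => zero_ne_one (congrFun h w)⟩⟩

/-- **Norm one in a common frame** (non-split `v`): if `g, g′ ∈ U(Φ₂)(L⁺_v)` are diagonalised by the same frame `P` with eigenvalues `(α, β)` and `(α, γ)`, `α, β, γ` pairwise
distinct, then `σ(α)α = σ(β)β = 1` — by ★ `forall_norm_eq_one_or_hyperbolic` twice: a hyperbolic pair `σ(α)β = 1` for `g` would give `σ(α)α = 1 ⇒ α = β` or
`σ(α)γ = 1 ⇒ β = γ` from `g′` (the norm of `γ` is not needed). [cite: Rogawski1990, §3.5 p. 29; §3.6 p. 31] -/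
private theorem conj_mul_self_eq_one_of_common_frame (w : PlacesOver L v) (hw : IsCMField.complexConj L • w.1 = w.1)
    {g g' P : GL (Fin 2) (LocalRing L v)}
    (hg : g ∈ unitaryGroup (conjLocal L (IsCMField.complexConj L) v)
      ((adelicForm L 2 (Matrix.of fun i j : Fin 2 => if i.val + j.val + 1 = 2 then (1 : L) else 0)).map (adeleToLocal L v)))
    (hg' : g' ∈ unitaryGroup (conjLocal L (IsCMField.complexConj L) v)
      ((adelicForm L 2 (Matrix.of fun i j : Fin 2 => if i.val + j.val + 1 = 2 then (1 : L) else 0)).map (adeleToLocal L v)))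
    {α β γ : LocalRing L v}
    (hP : (g.val : Matrix (Fin 2) (Fin 2) (LocalRing L v)) * P.val = P.val * diagonal ![α, β])
    (hP' : (g'.val : Matrix (Fin 2) (Fin 2) (LocalRing L v)) * P.val = P.val * diagonal ![α, γ])
    (hβα : β ≠ α) (hγα : γ ≠ α) (hγβ : γ ≠ β) :
    conjLocal L (IsCMField.complexConj L) v α * α = 1 ∧ conjLocal L (IsCMField.complexConj L) v β * β = 1 := by
  have hc1 : IsCMField.complexConj L ≠ 1 := IsCMField.complexConj_ne_one L
  letI : Field (LocalRing L v) := (LocalRing.isField_of_smul_eq (IsCMField.complexConj L) hc1 w hw).toField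
  obtain ⟨αg, hα0, hcα, -⟩ := cmQuadraticGenerator_spec L
  have hσσ : ∀ r : LocalRing L v, conjLocal L (IsCMField.complexConj L) v (conjLocal L (IsCMField.complexConj L) v r) = r :=
    Liu2021.LemD1OfPlace.conjLocal_conjLocal_apply L v (IsCMField.complexConj L) hcα hα0
  have hH2 := adelicForm_antidiagTwo_local_hermitian L v
  have hH2d : ((adelicForm L 2 (Matrix.of fun i j : Fin 2 => if i.val + j.val + 1 = 2 then (1 : L) else 0)).map (adeleToLocal L v)).det ≠ 0 :=
    (isUnit_det_adelicForm_antidiagTwo_local L v).ne_zero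
  have hn2 : ∀ i, conjLocal L (IsCMField.complexConj L) v (![α, β] i) * ![α, β] i = 1 := by
    rcases forall_norm_eq_one_or_hyperbolic (conjLocal L (IsCMField.complexConj L) v) _ hσσ hH2 hH2d hg hP (injective_vecTwo_of_ne hβα.symm) with h | ⟨hαβ, -⟩
    · exact h
    · exfalso
      have hαβ' : conjLocal L (IsCMField.complexConj L) v α * β = 1 := by simpa using hαβ
      have hσα : conjLocal L (IsCMField.complexConj L) v α ≠ 0 := fun h0 => by rw [h0, zero_mul] at hαβ'; exact zero_ne_one hαβ'
      rcases forall_norm_eq_one_or_hyperbolic (conjLocal L (IsCMField.complexConj L) v) _ hσσ hH2 hH2d hg' hP' (injective_vecTwo_of_ne hγα.symm) with h' | ⟨hαγ, -⟩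
      · have hαα : conjLocal L (IsCMField.complexConj L) v α * α = 1 := by simpa using h' 0
        exact hβα (mul_left_cancel₀ hσα (hαβ'.trans hαα.symm))
      · have hαγ' : conjLocal L (IsCMField.complexConj L) v α * γ = 1 := by simpa using hαγ
        exact hγβ (mul_left_cancel₀ hσα (hαγ'.trans hαβ'.symm))
  exact ⟨by simpa using hn2 0, by simpa using hn2 1⟩

/-! ## §0′ Dock algebra: `θ z = y·ι_v(z)·y⁻¹` -/

set_option maxHeartbeats 400000 in
/-- **Conjugating on the `U(Φ₂)`-factor is conjugating by `y·ι(x, 1)·y⁻¹` on the dock**: for `h = (g, u) ∈ H_v` and `x ∈ GL₂` with `x g x⁻¹ ∈ U(Φ₂)_v`,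
`(y ι(x,1) y⁻¹) · θ(h) · (y ι(x,1) y⁻¹)⁻¹ = θ(x g x⁻¹, u)`. [cite: Rogawski1990, §4.3 p. 42; §4.8 Case (a) p. 53] -/
theorem dock_conj_endoGL_eq {ε : (cmDatum L 3 H').Local v} (y : GL (Fin 3) (LocalRing L v))
    (θ : ((cmDatum L 2 (Matrix.of fun i j : Fin 2 => if i.val + j.val + 1 = 2 then (1 : L) else 0)).Local v ×
      (cmDatum L 1 (Matrix.of fun i j : Fin 1 => if i.val + j.val + 1 = 1 then (1 : L) else 0)).Local v) ≃ₜ* ↥(Subgroup.centralizer ({ε} : Set ((cmDatum L 3 H').Local v))))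
    (hθ : ∀ z : ((cmDatum L 2 (Matrix.of fun i j : Fin 2 => if i.val + j.val + 1 = 2 then (1 : L) else 0)).Local v ×
      (cmDatum L 1 (Matrix.of fun i j : Fin 1 => if i.val + j.val + 1 = 1 then (1 : L) else 0)).Local v),
      (((θ z).1).val : GL (Fin 3) (LocalRing L v)) = y * ((endoEmbLocal L v z).val : GL (Fin 3) (LocalRing L v)) * y⁻¹)
    (h : ((cmDatum L 2 (Matrix.of fun i j : Fin 2 => if i.val + j.val + 1 = 2 then (1 : L) else 0)).Local v ×
      (cmDatum L 1 (Matrix.of fun i j : Fin 1 => if i.val + j.val + 1 = 1 then (1 : L) else 0)).Local v)) {x : GL (Fin 2) (LocalRing L v)}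
    (hx : x * (h.1.val : GL (Fin 2) (LocalRing L v)) * x⁻¹ ∈ unitaryGroup (conjLocal L (IsCMField.complexConj L) v)
      ((adelicForm L 2 (Matrix.of fun i j : Fin 2 => if i.val + j.val + 1 = 2 then (1 : L) else 0)).map (adeleToLocal L v))) :
    (y * endoGL (x, (1 : GL (Fin 1) (LocalRing L v))) * y⁻¹) * ((((θ h : ↥(Subgroup.centralizer ({ε} : Set ((cmDatum L 3 H').Local v))))) : (cmDatum L 3 H').Local v).val : GL (Fin 3) (LocalRing L v)) *
        (y * endoGL (x, (1 : GL (Fin 1) (LocalRing L v))) * y⁻¹)⁻¹ =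
      ((((θ ((⟨x * (h.1.val : GL (Fin 2) (LocalRing L v)) * x⁻¹, hx⟩, h.2) : ((cmDatum L 2 (Matrix.of fun i j : Fin 2 => if i.val + j.val + 1 = 2 then (1 : L) else 0)).Local v ×
      (cmDatum L 1 (Matrix.of fun i j : Fin 1 => if i.val + j.val + 1 = 1 then (1 : L) else 0)).Local v)) : ↥(Subgroup.centralizer ({ε} : Set ((cmDatum L 3 H').Local v))))) : (cmDatum L 3 H').Local v).val : GL (Fin 3) (LocalRing L v)) := by
  have hι : ((endoEmbLocal L v ((⟨x * (h.1.val : GL (Fin 2) (LocalRing L v)) * x⁻¹, hx⟩, h.2) : ((cmDatum L 2 (Matrix.of fun i j : Fin 2 => if i.val + j.val + 1 = 2 then (1 : L) else 0)).Local v ×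
      (cmDatum L 1 (Matrix.of fun i j : Fin 1 => if i.val + j.val + 1 = 1 then (1 : L) else 0)).Local v))).val : GL (Fin 3) (LocalRing L v)) *
        endoGL (x, (1 : GL (Fin 1) (LocalRing L v))) =
      endoGL (x, (1 : GL (Fin 1) (LocalRing L v))) * ((endoEmbLocal L v h).val : GL (Fin 3) (LocalRing L v)) := by
    rw [coe_endoEmbLocal, coe_endoEmbLocal, ← map_mul endoGL, ← map_mul endoGL, Prod.mk_mul_mk, Prod.mk_mul_mk]
    show endoGL (x * (h.1.val : GL (Fin 2) (LocalRing L v)) * x⁻¹ * x, (h.2.val : GL (Fin 1) (LocalRing L v)) * 1) =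
      endoGL (x * (h.1.val : GL (Fin 2) (LocalRing L v)), 1 * (h.2.val : GL (Fin 1) (LocalRing L v)))
    rw [inv_mul_cancel_right, mul_one, one_mul]
  rw [hθ, hθ, eq_mul_inv_of_mul_eq hι]; group

/-- **The eigenframe of a docked torus point**: if `t′ = (g′, u′)` with `g′·P = P·diag(α, γ)` and `u′ = β`, then `θ(t′) = y·ι(t′)·y⁻¹` has the eigenframe `y·ι(P, 1)`
with eigenvalues `(α, β, γ)` (plane slots `0, 2`, middle slot = the `ι`-line). [cite: Rogawski1990, §4.8 Case (a) p. 53; §8.2 p. 113] -/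
theorem dock_val_mul_frame_eq {ε : (cmDatum L 3 H').Local v} (y : GL (Fin 3) (LocalRing L v))
    (θ : ((cmDatum L 2 (Matrix.of fun i j : Fin 2 => if i.val + j.val + 1 = 2 then (1 : L) else 0)).Local v ×
      (cmDatum L 1 (Matrix.of fun i j : Fin 1 => if i.val + j.val + 1 = 1 then (1 : L) else 0)).Local v) ≃ₜ* ↥(Subgroup.centralizer ({ε} : Set ((cmDatum L 3 H').Local v))))
    (hθ : ∀ z : ((cmDatum L 2 (Matrix.of fun i j : Fin 2 => if i.val + j.val + 1 = 2 then (1 : L) else 0)).Local v ×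
      (cmDatum L 1 (Matrix.of fun i j : Fin 1 => if i.val + j.val + 1 = 1 then (1 : L) else 0)).Local v),
      (((θ z).1).val : GL (Fin 3) (LocalRing L v)) = y * ((endoEmbLocal L v z).val : GL (Fin 3) (LocalRing L v)) * y⁻¹)
    {t' : ((cmDatum L 2 (Matrix.of fun i j : Fin 2 => if i.val + j.val + 1 = 2 then (1 : L) else 0)).Local v ×
      (cmDatum L 1 (Matrix.of fun i j : Fin 1 => if i.val + j.val + 1 = 1 then (1 : L) else 0)).Local v)} (P : GL (Fin 2) (LocalRing L v)) {α β γ : LocalRing L v}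
    (ht' : (t'.1.val.val : Matrix (Fin 2) (Fin 2) (LocalRing L v)) * P.val = P.val * diagonal ![α, γ])
    (ht'u : (t'.2.val.val : Matrix (Fin 1) (Fin 1) (LocalRing L v)) = β • (1 : Matrix (Fin 1) (Fin 1) (LocalRing L v))) :
    ((((θ t' : ↥(Subgroup.centralizer ({ε} : Set ((cmDatum L 3 H').Local v))))) : (cmDatum L 3 H').Local v).val.val : Matrix (Fin 3) (Fin 3) (LocalRing L v)) * (y * endoGL (P, (1 : GL (Fin 1) (LocalRing L v)))).val =
      (y * endoGL (P, (1 : GL (Fin 1) (LocalRing L v)))).val * diagonal ![α, β, γ] := by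
  have h00 : ((t'.2.val : GL (Fin 1) (LocalRing L v)).val : Matrix (Fin 1) (Fin 1) (LocalRing L v)) 0 0 = β := by rw [ht'u]; simp
  have hD : ((endoGL (P, (1 : GL (Fin 1) (LocalRing L v))))⁻¹ * endoGL ((t'.1.val : GL (Fin 2) (LocalRing L v)), (t'.2.val : GL (Fin 1) (LocalRing L v))) *
      endoGL (P, (1 : GL (Fin 1) (LocalRing L v))) : GL (Fin 3) (LocalRing L v)).val = diagonal ![α, β, γ] := by
    rw [val_endoGL_frame_conj P (t'.1.val : GL (Fin 2) (LocalRing L v)) (t'.2.val : GL (Fin 1) (LocalRing L v)) ht', h00, etaExpand_eq_diagonal_three]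
  have e1 : ((((θ t' : ↥(Subgroup.centralizer ({ε} : Set ((cmDatum L 3 H').Local v))))) : (cmDatum L 3 H').Local v).val : GL (Fin 3) (LocalRing L v)) * (y * endoGL (P, (1 : GL (Fin 1) (LocalRing L v)))) =
      (y * endoGL (P, (1 : GL (Fin 1) (LocalRing L v)))) *
        ((endoGL (P, (1 : GL (Fin 1) (LocalRing L v))))⁻¹ * endoGL ((t'.1.val : GL (Fin 2) (LocalRing L v)), (t'.2.val : GL (Fin 1) (LocalRing L v))) *
          endoGL (P, (1 : GL (Fin 1) (LocalRing L v)))) := by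
    rw [hθ t', coe_endoEmbLocal]; group
  rw [← Units.val_mul, e1, Units.val_mul, hD]

/-! ## §1 The element form: at a `G`-regular torus point, the second class of `τ t` carries the opposite `Δ‴_v(↑t, θ ·)` -/

open scoped Classical in
/-- **(J2a), ELEMENT FORM.**  Non-split `v` (`w ∣ v`, `w̄ = w`), `H′` hermitian with `det H′ ≠ 0`; a dock `θ : H_v ≃ₜ* Z_{G′_v}(ε)` with `θ z = y·ι_v(z)·y⁻¹` and form relation
`ᵗ(σy) H′_v y = a₀·Φ₃`, `a₀` a unit (★ `exists_centralDock_form_of_fst_eq_smul_one`); torus points `t = (P·diag(α, β)·P⁻¹, γ)` and `t′ = (P·diag(α, γ)·P⁻¹, β)` of `H_v` in a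
common frame `P` (★ `exists_torusTransport_frame`: `t′ = τ t`), both `G`-regular.  THEN there is `h′ ∈ H_v` stably conjugate and NOT conjugate to `t′`, such that every element
stably conjugate to `t′` is conjugate to `t′` or to `h′` (the stable class of `t′` is exactly two classes), AND `Δ‴_v(↑t, θ h′) = −Δ‴_v(↑t, θ t′)` — the second class is
`h′ = (x·t′.1·x⁻¹, β)` for a stable conjugator `x` failing the `Φ₂`-norm tests, the `U(Φ₁)`-coordinate `γ` of the first slot `t` sits in the plane of `t′.1`, and `κ_v(t, ·)` flips
along the dock (★ `finKappaAt_dock_conj_eq_neg_of_formCongr_eq_smul`); the eigenvalues `α, β, γ` are pairwise distinct (regularity of `t`, `t′`) and of norm one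
(★ `forall_norm_eq_one_or_hyperbolic` in the common frame). [cite: Rogawski1990, §8.2 Prop. 8.2.1 (c) pp. 113–115; §4.3 (4.3.2) p. 43; §3.5 Prop. 3.5.2 (c) p. 29; §3.6 p. 31]
[cite: LabesseLanglands1979, §2] -/
theorem exists_isLocalStablyConjH_finExplicitDelta_dock_eq_neg (w : PlacesOver L v) (hw : IsCMField.complexConj L • w.1 = w.1)
    (hH' : (H'.map (cmConjRingHom L))ᵀ = H') (hdet' : H'.det ≠ 0) (μ : HeckeCharacter L)
    {ε : (cmDatum L 3 H').Local v} (y : GL (Fin 3) (LocalRing L v))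
    (θ : ((cmDatum L 2 (Matrix.of fun i j : Fin 2 => if i.val + j.val + 1 = 2 then (1 : L) else 0)).Local v ×
      (cmDatum L 1 (Matrix.of fun i j : Fin 1 => if i.val + j.val + 1 = 1 then (1 : L) else 0)).Local v) ≃ₜ* ↥(Subgroup.centralizer ({ε} : Set ((cmDatum L 3 H').Local v))))
    (hθ : ∀ z : ((cmDatum L 2 (Matrix.of fun i j : Fin 2 => if i.val + j.val + 1 = 2 then (1 : L) else 0)).Local v ×
      (cmDatum L 1 (Matrix.of fun i j : Fin 1 => if i.val + j.val + 1 = 1 then (1 : L) else 0)).Local v),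
      (((θ z).1).val : GL (Fin 3) (LocalRing L v)) = y * ((endoEmbLocal L v z).val : GL (Fin 3) (LocalRing L v)) * y⁻¹)
    {a₀ : LocalRing L v} (ha₀ : IsUnit a₀)
    (hy : formCongr (conjLocal L (IsCMField.complexConj L) v) y ((adelicForm L 3 H').map (adeleToLocal L v)) =
      a₀ • (Matrix.of fun i j : Fin 3 => if i.val + j.val + 1 = 3 then (1 : LocalRing L v) else 0))
    {t t' : ((cmDatum L 2 (Matrix.of fun i j : Fin 2 => if i.val + j.val + 1 = 2 then (1 : L) else 0)).Local v ×
      (cmDatum L 1 (Matrix.of fun i j : Fin 1 => if i.val + j.val + 1 = 1 then (1 : L) else 0)).Local v)}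
    (P : GL (Fin 2) (LocalRing L v)) {α β : LocalRing L v}
    (ht : (t.1.val.val : Matrix (Fin 2) (Fin 2) (LocalRing L v)) * P.val = P.val * diagonal ![α, β])
    (ht' : (t'.1.val.val : Matrix (Fin 2) (Fin 2) (LocalRing L v)) * P.val = P.val * diagonal ![α, finGammaTwo L v t])
    (ht'u : (t'.2.val.val : Matrix (Fin 1) (Fin 1) (LocalRing L v)) = β • (1 : Matrix (Fin 1) (Fin 1) (LocalRing L v)))
    (hreg : IsLocalGRegular L v t) (hreg' : IsLocalGRegular L v t') :
    ∃ h' : ((cmDatum L 2 (Matrix.of fun i j : Fin 2 => if i.val + j.val + 1 = 2 then (1 : L) else 0)).Local v ×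
        (cmDatum L 1 (Matrix.of fun i j : Fin 1 => if i.val + j.val + 1 = 1 then (1 : L) else 0)).Local v),
      IsLocalStablyConjH L v t' h' ∧ ¬ IsConj t' h' ∧ (∀ k, IsLocalStablyConjH L v t' k → IsConj t' k ∨ IsConj h' k) ∧
        finExplicitDelta L v H' t μ ((θ h' : ↥(Subgroup.centralizer ({ε} : Set ((cmDatum L 3 H').Local v)))) : (cmDatum L 3 H').Local v) =
          - finExplicitDelta L v H' t μ ((θ t' : ↥(Subgroup.centralizer ({ε} : Set ((cmDatum L 3 H').Local v)))) : (cmDatum L 3 H').Local v) := by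
  have hc1 : IsCMField.complexConj L ≠ 1 := IsCMField.complexConj_ne_one L
  haveI hv : Subsingleton (PlacesOver L v) := PlacesOver.subsingleton_of_smul_eq (IsCMField.complexConj L) hc1 w hw
  haveI := nontrivial_localRing_of_nonempty_placesOver L v
  obtain ⟨αg, hα0, hcα, -⟩ := cmQuadraticGenerator_spec L
  have hH2 := adelicForm_antidiagTwo_local_hermitian L v
  have hH2d := isUnit_det_adelicForm_antidiagTwo_local L v
  have hH3 := UnitaryGroup.map_conjLocal_transpose_localForm L 3 H' v hH'
  have hH3d := UnitaryGroup.isUnit_det_localForm L 3 H' v hdet'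
  -- the three eigenvalues `α, β, γ` (`γ = u(t)`, `β = u(t′)`)
  have hγ' : finGammaTwo L v t' = β := by
    show (t'.2.val.val : Matrix (Fin 1) (Fin 1) (LocalRing L v)) 0 0 = β
    rw [ht'u]; simp
  -- distinctness from `G`-regularity of `t` and `t′`
  have hu : IsUnit ((finCharpolyTwo L v t).eval (finGammaTwo L v t)) := isUnit_eval_finCharpolyTwo_of_isLocalGRegular L v _ hreg
  have hu₁ := hu
  rw [eval_finCharpolyTwo_eq_of_frame P ht] at hu₁
  have hu₂ := isUnit_eval_finCharpolyTwo_of_isLocalGRegular L v _ hreg'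
  rw [eval_finCharpolyTwo_eq_of_frame P ht', hγ'] at hu₂
  have hγα : finGammaTwo L v t ≠ α := sub_ne_zero.1 (isUnit_of_mul_isUnit_left hu₁).ne_zero
  have hγβ : finGammaTwo L v t ≠ β := sub_ne_zero.1 (isUnit_of_mul_isUnit_right hu₁).ne_zero
  have hβα : β ≠ α := sub_ne_zero.1 (isUnit_of_mul_isUnit_left hu₂).ne_zero
  have hinj2' : Function.Injective ![α, finGammaTwo L v t] := injective_vecTwo_of_ne hγα.symm
  have hinj3 : Function.Injective ![α, β, finGammaTwo L v t] := injective_vecThree_of_pairwise_ne hβα.symm hγα.symm hγβ.symm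
  -- norm one
  have hγ1 : conjLocal L (IsCMField.complexConj L) v (finGammaTwo L v t) * finGammaTwo L v t = 1 := conjLocal_finGammaTwo_mul_finGammaTwo L v t
  obtain ⟨hα1, hβ1⟩ := conj_mul_self_eq_one_of_common_frame L v w hw t.1.2 t'.1.2 ht ht' hβα hγα hγβ
  have hn2' : ∀ i, conjLocal L (IsCMField.complexConj L) v (![α, finGammaTwo L v t] i) * ![α, finGammaTwo L v t] i = 1 := by
    intro i; fin_cases i
    · simpa using hα1
    · simpa using hγ1
  have hn3 : ∀ i, conjLocal L (IsCMField.complexConj L) v (![α, β, finGammaTwo L v t] i) * ![α, β, finGammaTwo L v t] i = 1 := by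
    intro i; fin_cases i
    · simpa using hα1
    · simpa using hβ1
    · simpa using hγ1
  -- THE TWO CLASSES of the stable class of `t′` (rank two on the `U(Φ₂)`-factor, ★ B-p04)
  obtain ⟨x, hxmem, hfail0, hst, hnc, hall⟩ := exists_isStablyConj_not_isConj_forall_isConj_or_rankTwo L v (IsCMField.complexConj L) hcα hα0 w hw hH2 hH2d
    t'.1.2 ht' hinj2' hn2'
  -- the failing test at column `1` of `P`, against the literal `Φ₂`
  have hfail1 : ¬ ∃ z : LocalRing L v, IsUnit z ∧
      twistGram (conjLocal L (IsCMField.complexConj L) v) (Matrix.of fun i j : Fin 2 => if i.val + j.val + 1 = 2 then (1 : LocalRing L v) else 0)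
          (x.val * P.val) 1 1 =
        conjLocal L (IsCMField.complexConj L) v z * z *
          twistGram (conjLocal L (IsCMField.complexConj L) v) (Matrix.of fun i j : Fin 2 => if i.val + j.val + 1 = 2 then (1 : LocalRing L v) else 0) P.val 1 1 := by
    rw [← localForm_antidiagTwo_eq_literal L v]
    exact fun h1 => hfail0 ((normTest_zero_iff_normTest_one_rankTwo L v (IsCMField.complexConj L) hcα hα0 w hw hH2 hH2d t'.1.2 ht' hinj2' hn2' hxmem).2 h1)
  -- the second class `h′ = (x·t′.1·x⁻¹, β)`
  have hst' : IsLocalStablyConjH L v t' (⟨x * (t'.1.val : GL (Fin 2) (LocalRing L v)) * x⁻¹, hxmem⟩, t'.2) := ⟨hst, IsStablyConj.refl _⟩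
  refine ⟨(⟨x * (t'.1.val : GL (Fin 2) (LocalRing L v)) * x⁻¹, hxmem⟩, t'.2), hst', fun hc => hnc (isConj_prod_mk_iff_of_components.1 hc).1, fun k hk => ?_, ?_⟩
  · have h2 : t'.2 = k.2 := hk.snd_eq
    rcases hall ⟨k.1.val, k.1.2⟩ hk.1 with h1 | h1
    · exact Or.inl (isConj_prod_mk_iff_of_components.2 ⟨h1, by rw [h2]⟩)
    · exact Or.inr (isConj_prod_mk_iff_of_components.2 ⟨h1, by rw [h2]⟩)
  -- THE SIGN along the dock
  have hb : ((((θ t' : ↥(Subgroup.centralizer ({ε} : Set ((cmDatum L 3 H').Local v)))) : (cmDatum L 3 H').Local v)).val : GL (Fin 3) (LocalRing L v)) =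
      y * ((endoEmbLocal L v t').val : GL (Fin 3) (LocalRing L v)) * y⁻¹ := hθ t'
  have hmatch : IsLocalNormPair L H' v t ((θ t' : ↥(Subgroup.centralizer ({ε} : Set ((cmDatum L 3 H').Local v)))) : (cmDatum L 3 H').Local v) :=
    isLocalNormPair_of_frames_of_val_eq_conj P ht ht' ht'u hb
  have hPb := dock_val_mul_frame_eq L H' v y θ hθ P ht' ht'u
  have hj : ![α, finGammaTwo L v t] 1 = finGammaTwo L v t := by simp
  have hg := dock_conj_endoGL_eq L H' v y θ hθ t' hxmem
  have hκ : finKappaAt L v H' t ((θ ((⟨x * (t'.1.val : GL (Fin 2) (LocalRing L v)) * x⁻¹, hxmem⟩, t'.2) : ((cmDatum L 2 (Matrix.of fun i j : Fin 2 => if i.val + j.val + 1 = 2 then (1 : L) else 0)).Local v × (cmDatum L 1 (Matrix.of fun i j : Fin 1 => if i.val + j.val + 1 = 1 then (1 : L) else 0)).Local v)) : ↥(Subgroup.centralizer ({ε} : Set ((cmDatum L 3 H').Local v)))) : (cmDatum L 3 H').Local v) =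
      - finKappaAt L v H' t ((θ t' : ↥(Subgroup.centralizer ({ε} : Set ((cmDatum L 3 H').Local v)))) : (cmDatum L 3 H').Local v) :=
    finKappaAt_dock_conj_eq_neg_of_formCongr_eq_smul L v H' w hw hmatch hu hH3 hH3d ha₀ hy hPb hinj3 hn3 hj hfail1 hg
  have hmatch' : IsLocalNormPair L H' v t ((θ ((⟨x * (t'.1.val : GL (Fin 2) (LocalRing L v)) * x⁻¹, hxmem⟩, t'.2) : ((cmDatum L 2 (Matrix.of fun i j : Fin 2 => if i.val + j.val + 1 = 2 then (1 : L) else 0)).Local v × (cmDatum L 1 (Matrix.of fun i j : Fin 1 => if i.val + j.val + 1 = 1 then (1 : L) else 0)).Local v)) : ↥(Subgroup.centralizer ({ε} : Set ((cmDatum L 3 H').Local v)))) : (cmDatum L 3 H').Local v) :=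
    IsConj.trans hmatch (isConj_iff.2 ⟨_, hg⟩)
  rw [finExplicitDelta_of_isLocalNormPair L v H' _ μ hmatch', finExplicitDelta_of_isLocalNormPair L v H' _ μ hmatch, hκ]
  push_cast
  ring

/-! ## §2 HEAD — the binder `halt` of the torus unstable junction, verbatim -/

open scoped Classical in
/-- **(J2a) THE κ-ALTERNATION AT THE TORUS BASE — binder `halt` of ★ `exists_nhds_finsum_delta_dock_eq_locallyConstant_of_torusTransfer` (B-p08, p842095) and of ★
`exists_nhds_finsum_delta_dock_eq_locallyConstant_of_frame` (p842287), VERBATIM, DISCHARGED.**  Non-split `v`; `H′` hermitian, `det H′ ≠ 0`; the torus `C = Z_H(ε_H)` diagonalised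
by `P` (`ht1`); the transport `τ t = (P·diag(α_t, γ_t)·P⁻¹, β_t)` (`hτ1`, `hτ2`) preserving `G`-regularity (`hτreg`) — conjuncts of ★ `exists_torusTransport_frame` BY NAME; the
central dock `θ z = y·ι_v(z)·y⁻¹` WITH its form relation `ᵗ(σy) H′_v y = a₀·Φ₃`, `a₀` a unit — conjuncts of ★ `exists_centralDock_form_of_fst_eq_smul_one` BY NAME; ANY base point
`b₀`.  CONCLUSION (with `V₁ := univ`): for every `G`-regular `t ∈ C` there is a class `d′ ≠ ⟦τ t⟧` with `{d | d ∼_st τ t} = {⟦τ t⟧, d′}` and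
`Δ‴_v(↑t, θ(out d′)) = −Δ‴_v(↑t, θ(out ⟦τ t⟧))` — §1 at `(t, τ t)`, the stable class of `τ t` being the union of the two conjugacy classes, and `Δ‴_v(↑t, ·)` a class function in
the second slot (`hr`) to pass to the representatives `out ⟦·⟧`. [cite: Rogawski1990, §8.2 Prop. 8.2.1 (c) pp. 113–115; §4.3 (4.3.2) p. 43; §3.5 Prop. 3.5.2 (c) p. 29]
[cite: LabesseLanglands1979, §2] -/
theorem exists_nhds_stableClass_pair_delta_dock_eq_neg_of_frame (w : PlacesOver L v) (hw : IsCMField.complexConj L • w.1 = w.1)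
    (hH' : (H'.map (cmConjRingHom L))ᵀ = H') (hdet' : H'.det ≠ 0) (μ : HeckeCharacter L)
    (hl : ∀ (v : HeightOneSpectrum (𝓞 ↥(maximalRealSubfield L))) (a : ((cmDatum L 2 (Matrix.of fun i j : Fin 2 => if i.val + j.val + 1 = 2 then (1 : L) else 0)).Local v ×
      (cmDatum L 1 (Matrix.of fun i j : Fin 1 => if i.val + j.val + 1 = 1 then (1 : L) else 0)).Local v)) (b : (cmDatum L 3 H').Local v) (x : ((cmDatum L 2 (Matrix.of fun i j : Fin 2 => if i.val + j.val + 1 = 2 then (1 : L) else 0)).Local v ×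
      (cmDatum L 1 (Matrix.of fun i j : Fin 1 => if i.val + j.val + 1 = 1 then (1 : L) else 0)).Local v)),
      finExplicitDelta L v H' (x * a * x⁻¹) μ b = finExplicitDelta L v H' a μ b)
    (hr : ∀ (v : HeightOneSpectrum (𝓞 ↥(maximalRealSubfield L))) (a : ((cmDatum L 2 (Matrix.of fun i j : Fin 2 => if i.val + j.val + 1 = 2 then (1 : L) else 0)).Local v ×
      (cmDatum L 1 (Matrix.of fun i j : Fin 1 => if i.val + j.val + 1 = 1 then (1 : L) else 0)).Local v)) (b y : (cmDatum L 3 H').Local v),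
      finExplicitDelta L v H' a μ (y * b * y⁻¹) = finExplicitDelta L v H' a μ b)
    (εH : ((cmDatum L 2 (Matrix.of fun i j : Fin 2 => if i.val + j.val + 1 = 2 then (1 : L) else 0)).Local v ×
      (cmDatum L 1 (Matrix.of fun i j : Fin 1 => if i.val + j.val + 1 = 1 then (1 : L) else 0)).Local v)) (P : GL (Fin 2) (LocalRing L v))
    (ht1 : ∀ t : ↥(Subgroup.centralizer ({εH} : Set ((cmDatum L 2 (Matrix.of fun i j : Fin 2 => if i.val + j.val + 1 = 2 then (1 : L) else 0)).Local v ×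
      (cmDatum L 1 (Matrix.of fun i j : Fin 1 => if i.val + j.val + 1 = 1 then (1 : L) else 0)).Local v))),
      (t.1.1.val.val : Matrix (Fin 2) (Fin 2) (LocalRing L v)) * P.val = P.val * diagonal ![(P⁻¹.val * t.1.1.val.val * P.val) 0 0, (P⁻¹.val * t.1.1.val.val * P.val) 1 1])
    (τ : ↥(Subgroup.centralizer ({εH} : Set ((cmDatum L 2 (Matrix.of fun i j : Fin 2 => if i.val + j.val + 1 = 2 then (1 : L) else 0)).Local v ×
      (cmDatum L 1 (Matrix.of fun i j : Fin 1 => if i.val + j.val + 1 = 1 then (1 : L) else 0)).Local v))) → ((cmDatum L 2 (Matrix.of fun i j : Fin 2 => if i.val + j.val + 1 = 2 then (1 : L) else 0)).Local v ×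
      (cmDatum L 1 (Matrix.of fun i j : Fin 1 => if i.val + j.val + 1 = 1 then (1 : L) else 0)).Local v))
    (hτreg : ∀ t : ↥(Subgroup.centralizer ({εH} : Set ((cmDatum L 2 (Matrix.of fun i j : Fin 2 => if i.val + j.val + 1 = 2 then (1 : L) else 0)).Local v ×
      (cmDatum L 1 (Matrix.of fun i j : Fin 1 => if i.val + j.val + 1 = 1 then (1 : L) else 0)).Local v))), IsLocalGRegular L v (t : ((cmDatum L 2 (Matrix.of fun i j : Fin 2 => if i.val + j.val + 1 = 2 then (1 : L) else 0)).Local v ×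
      (cmDatum L 1 (Matrix.of fun i j : Fin 1 => if i.val + j.val + 1 = 1 then (1 : L) else 0)).Local v)) → IsLocalGRegular L v (τ t))
    (hτ1 : ∀ t : ↥(Subgroup.centralizer ({εH} : Set ((cmDatum L 2 (Matrix.of fun i j : Fin 2 => if i.val + j.val + 1 = 2 then (1 : L) else 0)).Local v ×
      (cmDatum L 1 (Matrix.of fun i j : Fin 1 => if i.val + j.val + 1 = 1 then (1 : L) else 0)).Local v))),
      ((τ t).1.val.val : Matrix (Fin 2) (Fin 2) (LocalRing L v)) * P.val = P.val * diagonal ![(P⁻¹.val * t.1.1.val.val * P.val) 0 0, finGammaTwo L v t.1])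
    (hτ2 : ∀ t : ↥(Subgroup.centralizer ({εH} : Set ((cmDatum L 2 (Matrix.of fun i j : Fin 2 => if i.val + j.val + 1 = 2 then (1 : L) else 0)).Local v ×
      (cmDatum L 1 (Matrix.of fun i j : Fin 1 => if i.val + j.val + 1 = 1 then (1 : L) else 0)).Local v))), ((τ t).2.val.val : Matrix (Fin 1) (Fin 1) (LocalRing L v)) = ((P⁻¹.val * t.1.1.val.val * P.val) 1 1) • (1 : Matrix (Fin 1) (Fin 1) (LocalRing L v)))
    {ε : (cmDatum L 3 H').Local v} (y : GL (Fin 3) (LocalRing L v)) (θ : ((cmDatum L 2 (Matrix.of fun i j : Fin 2 => if i.val + j.val + 1 = 2 then (1 : L) else 0)).Local v ×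
      (cmDatum L 1 (Matrix.of fun i j : Fin 1 => if i.val + j.val + 1 = 1 then (1 : L) else 0)).Local v) ≃ₜ* ↥(Subgroup.centralizer ({ε} : Set ((cmDatum L 3 H').Local v))))
    (hθ : ∀ z : ((cmDatum L 2 (Matrix.of fun i j : Fin 2 => if i.val + j.val + 1 = 2 then (1 : L) else 0)).Local v ×
      (cmDatum L 1 (Matrix.of fun i j : Fin 1 => if i.val + j.val + 1 = 1 then (1 : L) else 0)).Local v), (((θ z).1).val : GL (Fin 3) (LocalRing L v)) = y * ((endoEmbLocal L v z).val : GL (Fin 3) (LocalRing L v)) * y⁻¹)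
    {a₀ : LocalRing L v} (ha₀ : IsUnit a₀)
    (hy : formCongr (conjLocal L (IsCMField.complexConj L) v) y ((adelicForm L 3 H').map (adeleToLocal L v)) =
      a₀ • (Matrix.of fun i j : Fin 3 => if i.val + j.val + 1 = 3 then (1 : LocalRing L v) else 0))
    (b₀ : ↥(Subgroup.centralizer ({εH} : Set ((cmDatum L 2 (Matrix.of fun i j : Fin 2 => if i.val + j.val + 1 = 2 then (1 : L) else 0)).Local v ×
      (cmDatum L 1 (Matrix.of fun i j : Fin 1 => if i.val + j.val + 1 = 1 then (1 : L) else 0)).Local v)))) :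
    ∃ V₁ ∈ 𝓝 b₀, ∀ t ∈ V₁, IsLocalGRegular L v (t : (((cmDatum L 2 (Matrix.of fun i j : Fin 2 => if i.val + j.val + 1 = 2 then (1 : L) else 0)).Local v) ×
      ((cmDatum L 1 (Matrix.of fun i j : Fin 1 => if i.val + j.val + 1 = 1 then (1 : L) else 0)).Local v))) → ∃ d' : ConjClasses (((cmDatum L 2 (Matrix.of fun i j : Fin 2 => if i.val + j.val + 1 = 2 then (1 : L) else 0)).Local v) ×
      ((cmDatum L 1 (Matrix.of fun i j : Fin 1 => if i.val + j.val + 1 = 1 then (1 : L) else 0)).Local v)), d' ≠ ConjClasses.mk (τ t) ∧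
        {d : ConjClasses (((cmDatum L 2 (Matrix.of fun i j : Fin 2 => if i.val + j.val + 1 = 2 then (1 : L) else 0)).Local v) ×
      ((cmDatum L 1 (Matrix.of fun i j : Fin 1 => if i.val + j.val + 1 = 1 then (1 : L) else 0)).Local v)) | IsLocalStablyConjH L v (τ t) (Quotient.out d)} = {ConjClasses.mk (τ t), d'} ∧
        ((finExplicitCollection L H' μ hl hr) v).Δ (t : (((cmDatum L 2 (Matrix.of fun i j : Fin 2 => if i.val + j.val + 1 = 2 then (1 : L) else 0)).Local v) ×
      ((cmDatum L 1 (Matrix.of fun i j : Fin 1 => if i.val + j.val + 1 = 1 then (1 : L) else 0)).Local v))) ((θ (Quotient.out d') : ↥(Subgroup.centralizer ({ε} : Set ((cmDatum L 3 H').Local v)))) : ((cmDatum L 3 H').Local v)) =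
          - ((finExplicitCollection L H' μ hl hr) v).Δ (t : (((cmDatum L 2 (Matrix.of fun i j : Fin 2 => if i.val + j.val + 1 = 2 then (1 : L) else 0)).Local v) ×
      ((cmDatum L 1 (Matrix.of fun i j : Fin 1 => if i.val + j.val + 1 = 1 then (1 : L) else 0)).Local v))) ((θ (Quotient.out (ConjClasses.mk (τ t))) : ↥(Subgroup.centralizer ({ε} : Set ((cmDatum L 3 H').Local v)))) : ((cmDatum L 3 H').Local v)) := by
  refine ⟨Set.univ, Filter.univ_mem, fun t _ hreg => ?_⟩
  have hτu : ((τ t).2.val.val : Matrix (Fin 1) (Fin 1) (LocalRing L v)) = ((P⁻¹.val * t.1.1.val.val * P.val) 1 1) • (1 : Matrix (Fin 1) (Fin 1) (LocalRing L v)) := hτ2 t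
  obtain ⟨h', hst', hnc, hall, hΔ⟩ := exists_isLocalStablyConjH_finExplicitDelta_dock_eq_neg L H' v w hw hH' hdet' μ y θ hθ ha₀ hy P (ht1 t) (hτ1 t) hτu hreg (hτreg t hreg)
  -- classes and their chosen representatives
  have hout : ∀ c : ConjClasses (((cmDatum L 2 (Matrix.of fun i j : Fin 2 => if i.val + j.val + 1 = 2 then (1 : L) else 0)).Local v) ×
      ((cmDatum L 1 (Matrix.of fun i j : Fin 1 => if i.val + j.val + 1 = 1 then (1 : L) else 0)).Local v)), ConjClasses.mk (Quotient.out c) = c := fun c => by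
    rw [← ConjClasses.quotient_mk_eq_mk, Quotient.out_eq]
  have hstc : ∀ {a b : (((cmDatum L 2 (Matrix.of fun i j : Fin 2 => if i.val + j.val + 1 = 2 then (1 : L) else 0)).Local v) ×
      ((cmDatum L 1 (Matrix.of fun i j : Fin 1 => if i.val + j.val + 1 = 1 then (1 : L) else 0)).Local v))}, IsConj a b → IsLocalStablyConjH L v a b :=
    fun hab => isStablyConjH_of_isConj hab
  refine ⟨ConjClasses.mk h', fun he => hnc (ConjClasses.mk_eq_mk_iff_isConj.1 he.symm), Set.ext fun d => ⟨fun hd => ?_, fun hd => ?_⟩, ?_⟩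
  · rcases hall _ hd with h1 | h1
    · exact Or.inl ((hout d).symm.trans (ConjClasses.mk_eq_mk_iff_isConj.2 h1.symm))
    · exact Or.inr ((hout d).symm.trans (ConjClasses.mk_eq_mk_iff_isConj.2 h1.symm))
  · rcases hd with rfl | rfl
    · exact hstc (ConjClasses.mk_eq_mk_iff_isConj.1 (hout (ConjClasses.mk (τ t))).symm)
    · exact hst'.trans (hstc (ConjClasses.mk_eq_mk_iff_isConj.1 (hout (ConjClasses.mk h')).symm))
  -- `Δ‴_v(↑t, ·)` is a class function in the second slot: pass from `out ⟦·⟧` to the representatives `h′`, `τ t`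
  obtain ⟨c₁, hc₁⟩ := isConj_iff.1 (ConjClasses.mk_eq_mk_iff_isConj.1 (Quotient.out_eq (ConjClasses.mk h')).symm)
  obtain ⟨c₂, hc₂⟩ := isConj_iff.1 (ConjClasses.mk_eq_mk_iff_isConj.1 (Quotient.out_eq (ConjClasses.mk (τ t))).symm)
  rw [← hc₁, ← hc₂]
  simp only [map_mul, map_inv, Subgroup.coe_mul, Subgroup.coe_inv, finExplicitCollection_Δ]
  rw [hr, hr]
  exact hΔ

end CM

end Literature.NumberTheory.Rogawski1990

end
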